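import Summits.CriticalPhenomena.SAWScalingLimit.Theses.SAWCompassLattice
import Summits.CriticalPhenomena.SAWScalingLimit.Theorems.SAWDevelopingMapHexTransferPortTransfer
import Summits.CriticalPhenomena.SAWScalingLimit.Theorems.SAWLeftRightFKGTraversalBoundTight
import Literature.Probability.RandomPlanarGeometry.SLEConvergenceCriterion
import Literature.Probability.RandomPlanarGeometry.CurveTightness
import Literature.Probability.Percolation.InterfaceScalingLimitProofs

/-!
# `stub_ybTightOfTraversalBound` (T2 of the crux `CompassSLE`, stmt-CriticalPhenomena-6965,
# line registered = birth, skeleton v2): traversal bound ⇒ tightness along the mesh for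
# Glazman–Manolescu's critical `π/2` Yang–Baxter walk

The Aizenman–Burchard multi-traversal bound (T1, the HYPOTHESIS here) for the laws
`ybLaw (π/2) D.carrier δ 1 (a δ) (b δ)` and the drawn walks `⟨γ.path (π/2) δ⟩ : Curve ℂ` implies
`IsTightAlongMesh` of the curve classes `γ.curve (π/2) δ = CurveClass.mk ⟨γ.path (π/2) δ⟩`
(definitionally), by the tree's PROVED criterion `isTightMeasureSet_of_traversalBounds`
(`Literature/…/CurveTightness.lean`, AB99 Thms 1.1–1.2), exactly as for the `δℍ` SAW
(`Theorems/SAWDevelopingMapHexConjectureHexTightOfTraversalBound.lean`, the template) and the `δℤ²`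
SAW (`Theorems/SAWLeftRightFKGTraversalBoundTight.lean`, whose generic lemmas
`segMeetCount_map_le_card_of_chain`, `mem_Icc_floor_of_abs_le` are reused):

* container `Λ = B̄(0, r_Λ)`, `r_Λ = max r 0 + ‖a‖ + 1` with `D ⊆ B̄(0, r)`
  (`JordanDomain.isBounded`) and `a = D.pt 0`; covering exponent `d = 2`
  (`exists_finset_card_le_cover_closedBall`);
* random curves `X_δ γ = ⟨γ.path (π/2) δ⟩`, the polyline through the rescaled midpoints
  `δ · planeMidpoint (π/2) zᵢ` of the mid-edges crossed (`YBWalk.path`/`YBWalk.points`);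
* index set `T = (0, δ₁]`, `δ₁ = min (min δ₀ (δ₂/2)) 1`, where `δ · planeMidpoint (a δ) ∈ B(a, 1)`
  for `0 < δ < δ₂` (`IsYBEndpointApprox.tendsto_fst`; this only matters for the trivial walk
  `a δ = b δ`, whose single vertex need not lie in a face of `Ω_δ`);
* threshold `max 147 (k x ρ R)`;
* (H0): a walk with an arc is drawn inside `Ω ⊆ Λ` (`YBWalk.range_path_subset`), the trivial walk
  is the constant curve at `δ · planeMidpoint (a δ) ∈ B(a, 1) ⊆ Λ`
  (`range_path_subset_of_arcs_eq_nil`); and the SHORT-DISTANCE CUTOFF `not_hasTraversals_path`: at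
  mesh `δ` no Yang–Baxter polyline traverses a shell of inner radius `ρ ≤ δ` by
  `147 = 2 · (72 + 1) + 1` separate segments — consecutive mid-edges are sides of a common face
  (`arc_mem`, `exists_eq_side_of_eq_faces`), whose midpoints on the square tiling are at distance
  `1/2` from its centre (`PortTransfer.norm_planeMidpoint_side_sub`), so an arc whose rescaled
  segment meets `B̄(x, ρ)` starts within `2δ` of `x`; the midpoints of the `π/2` tiling are
  `vert k j ↦ k + j i`, `slant k j ↦ k + 1/2 + (j - 1/2) i` (`planeMidpoint_vert`/`_slant`), so all
  such start mid-edges lie in two `6 × 6` windows (`mem_midBox`, `card_union_image_window_le`: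
  `≤ 72`); a walk crosses each edge once (`YBWalk.nodup`), so the times in the ball are covered
  by `≤ 73` order-connected pieces carrying two traversals each (`not_hasTraversals_polyline_map`:
  `Percolation.hasOrdConnectedCover_preimage_polylineFrom`, `segMeetCount_map_le_card_of_chain`,
  `Percolation.le_of_hasTraversals_of_hasOrdConnectedCover`);
* (H1) is the hypothesis, weakened in the threshold (`Curve.HasTraversals.of_le`);
* finally `isTightAlongMesh_of_isTightMeasureSet_image` (a.e.-measurability is free on the discrete
  σ-algebra, `YBWalk.aemeasurable_curve`).

No named fact is used. References: M. Aizenman, A. Burchard, Duke Math. J. 99 (1999) 419–453,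
Thms 1.1–1.2 and §1.a (short-distance cutoff) [AizenmanBurchardDuke1999]; A. Glazman,
I. Manolescu, Ann. Inst. Henri Poincaré Probab. Stat. 56 (2020), §1 [GlazmanManolescu2019].
-/

noncomputable section

namespace Summit.CriticalPhenomena.SAWScalingLimit.Theorems.SAWCompassLatticeCompassSLE

open MeasureTheory Filter Topology Set Metric
open scoped NNReal ENNReal
open Literature.Probability.RandomPlanarGeometry
open Literature.Probability.RandomPlanarGeometry.SAW.YangBaxter
open Summit.CriticalPhenomena.SAWScalingLimit.Theses
open Literature.Probability.LatticeModels (polyline polylineFrom)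
open Literature.Probability.Percolation (segMeetCount hasOrdConnectedCover_preimage_polylineFrom
  le_of_hasTraversals_of_hasOrdConnectedCover)
open Summit.CriticalPhenomena.SAWScalingLimit.Cruxes.HexTransfer.Sketch (Endpoints.colShift_sq
  Endpoints.planeCorner_eq PortTransfer.norm_planeMidpoint_side_sub)
open Complex (I)

namespace TightOfTraversalBound

/-! ### The square tiling `Θ ≡ π/2`: midpoints and sides -/

/-- On the square tiling the midpoint of the vertical edge `vert k j` is `k + j i`. [folklore] -/
theorem planeMidpoint_vert (k j : ℤ) :
    planeMidpoint (fun (_ : ℤ) => Real.pi / 2) (.vert k j) = (k : ℂ) + (j : ℂ) * I := by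
  simp only [planeMidpoint, Endpoints.planeCorner_eq Endpoints.colShift_sq]
  ring

/-- On the square tiling the midpoint of the horizontal edge `slant k j` is
`k + 1/2 + (j - 1/2) i`. [folklore] -/
theorem planeMidpoint_slant (k j : ℤ) :
    planeMidpoint (fun (_ : ℤ) => Real.pi / 2) (.slant k j) =
      (k : ℂ) + 1 / 2 + ((j : ℂ) - 1 / 2) * I := by
  simp only [planeMidpoint, Endpoints.planeCorner_eq Endpoints.colShift_sq, Endpoints.colShift_sq]
  ring

/-- A mid-edge bordering the face `f` is one of its four sides. [folklore] -/
theorem exists_eq_side_of_eq_faces {e : MidEdge} {f : Face} (h : f = e.faces.1 ∨ f = e.faces.2) :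
    ∃ s : Side, e = f.side s := by
  obtain ⟨h1, h2⟩ := eq_side_faces e
  rcases h with rfl | rfl
  · exact h1.elim (fun h => ⟨_, h⟩) fun h => ⟨_, h⟩
  · exact h2.elim (fun h => ⟨_, h⟩) fun h => ⟨_, h⟩

/-- **Consecutive mid-edges of a Yang–Baxter walk on the square tiling are at distance `≤ 1`**:
two sides of a common unit square have midpoints at distance `1/2` from its centre. [folklore] -/
theorem norm_planeMidpoint_sub_le_of_commonFace {e e' : MidEdge} {f : Face}
    (h : MidEdge.commonFace e e' = some f) :
    ‖planeMidpoint (fun (_ : ℤ) => Real.pi / 2) e - planeMidpoint (fun (_ : ℤ) => Real.pi / 2) e'‖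
      ≤ 1 := by
  obtain ⟨h1, h2⟩ := eq_faces_of_commonFace h
  obtain ⟨s, rfl⟩ := exists_eq_side_of_eq_faces h1
  obtain ⟨s', rfl⟩ := exists_eq_side_of_eq_faces h2
  have hs := PortTransfer.norm_planeMidpoint_side_sub f s
  have hs' := PortTransfer.norm_planeMidpoint_side_sub f s'
  calc ‖planeMidpoint (fun (_ : ℤ) => Real.pi / 2) (f.side s) -
        planeMidpoint (fun (_ : ℤ) => Real.pi / 2) (f.side s')‖
      = ‖(planeMidpoint (fun (_ : ℤ) => Real.pi / 2) (f.side s) -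
            (planeCorner (fun (_ : ℤ) => Real.pi / 2) f + (1 + I) / 2)) -
          (planeMidpoint (fun (_ : ℤ) => Real.pi / 2) (f.side s') -
            (planeCorner (fun (_ : ℤ) => Real.pi / 2) f + (1 + I) / 2))‖ := by
        congr 1
        ring
    _ ≤ ‖planeMidpoint (fun (_ : ℤ) => Real.pi / 2) (f.side s) -
            (planeCorner (fun (_ : ℤ) => Real.pi / 2) f + (1 + I) / 2)‖ +
          ‖planeMidpoint (fun (_ : ℤ) => Real.pi / 2) (f.side s') -
            (planeCorner (fun (_ : ℤ) => Real.pi / 2) f + (1 + I) / 2)‖ := norm_sub_le _ _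
    _ = 1 := by rw [hs, hs']; norm_num

/-! ### The box of mid-edges near a point -/

/-- A `6 × 6` integer window has `36` points, so its image has at most `36`. [folklore] -/
theorem card_image_window_le (g : ℤ × ℤ → MidEdge) (m n : ℤ) :
    ((Finset.Icc (m - 2) (m + 3) ×ˢ Finset.Icc (n - 2) (n + 3)).image g).card ≤ 36 := by
  refine Finset.card_image_le.trans ?_
  have h1 : (m + 3 + 1 - (m - 2)).toNat = 6 := by omega
  have h2 : (n + 3 + 1 - (n - 2)).toNat = 6 := by omega
  rw [Finset.card_product, Int.card_Icc, Int.card_Icc, h1, h2]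

/-- Two images of `6 × 6` integer windows have at most `72` elements together (the size of the box
of mid-edges near a point). [folklore] -/
theorem card_union_image_window_le (g g' : ℤ × ℤ → MidEdge) (m n m' n' : ℤ) :
    ((Finset.Icc (m - 2) (m + 3) ×ˢ Finset.Icc (n - 2) (n + 3)).image g ∪
      (Finset.Icc (m' - 2) (m' + 3) ×ˢ Finset.Icc (n' - 2) (n' + 3)).image g').card ≤ 72 := by
  refine (Finset.card_union_le _ _).trans ?_
  have h1 := card_image_window_le g m n
  have h2 := card_image_window_le g' m' n'
  omega

/-- **The box of mid-edges near a point.** A mid-edge whose rescaled midpoint is within `2δ` of `x`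
is a vertical edge `vert k j` with `(k, j)` in the `6 × 6` integer window about `(x.re/δ, x.im/δ)`
or a horizontal edge `slant k j` with `(k, j)` in the window about
`((x.re - δ/2)/δ, (x.im + δ/2)/δ)` (the midpoints of the `π/2` tiling are `k + j i`, resp.
`k + 1/2 + (j - 1/2) i`). (Counting device for the short-distance cutoff, AB99 §1.a.) [folklore] -/
theorem mem_midBox {δ : ℝ} (hδ : 0 < δ) {x : ℂ} {e : MidEdge}
    (h : ‖(δ : ℂ) * planeMidpoint (fun (_ : ℤ) => Real.pi / 2) e - x‖ ≤ 2 * δ) :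
    e ∈ ((Finset.Icc (⌊x.re / δ⌋ - 2) (⌊x.re / δ⌋ + 3) ×ˢ
            Finset.Icc (⌊x.im / δ⌋ - 2) (⌊x.im / δ⌋ + 3)).image
          fun q : ℤ × ℤ => MidEdge.vert q.1 q.2) ∪
        ((Finset.Icc (⌊(x.re - δ / 2) / δ⌋ - 2) (⌊(x.re - δ / 2) / δ⌋ + 3) ×ˢ
            Finset.Icc (⌊(x.im + δ / 2) / δ⌋ - 2) (⌊(x.im + δ / 2) / δ⌋ + 3)).image
          fun q : ℤ × ℤ => MidEdge.slant q.1 q.2) := by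
  have hre := (Complex.abs_re_le_norm _).trans h
  have him := (Complex.abs_im_le_norm _).trans h
  rw [Finset.mem_union]
  cases e with
  | vert k j =>
    left
    rw [planeMidpoint_vert] at hre him
    have hre' : |δ * (k : ℝ) - x.re| ≤ 2 * δ := by simpa using hre
    have him' : |δ * (j : ℝ) - x.im| ≤ 2 * δ := by simpa using him
    exact Finset.mem_image.2 ⟨(k, j), Finset.mem_product.2
      ⟨mem_Icc_floor_of_abs_le hδ hre', mem_Icc_floor_of_abs_le hδ him'⟩, rfl⟩
  | slant k j =>
    right
    rw [planeMidpoint_slant] at hre him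
    have hre' : |δ * (k : ℝ) - (x.re - δ / 2)| ≤ 2 * δ := by
      have : ((δ : ℂ) * ((k : ℂ) + 1 / 2 + ((j : ℂ) - 1 / 2) * I) - x).re =
          δ * (k : ℝ) - (x.re - δ / 2) := by
        simp; ring
      rwa [this] at hre
    have him' : |δ * (j : ℝ) - (x.im + δ / 2)| ≤ 2 * δ := by
      have : ((δ : ℂ) * ((k : ℂ) + 1 / 2 + ((j : ℂ) - 1 / 2) * I) - x).im =
          δ * (j : ℝ) - (x.im + δ / 2) := by
        simp; ring
      rwa [this] at him
    exact Finset.mem_image.2 ⟨(k, j), Finset.mem_product.2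
      ⟨mem_Icc_floor_of_abs_le hδ hre', mem_Icc_floor_of_abs_le hδ him'⟩, rfl⟩

/-! ### The short-distance cutoff -/

/-- **No polyline through pairwise distinct labelled points traverses a shell many times near a
controlled set of labels**: if consecutive labels of `a :: l` are related by `r`, no label is
repeated, and every label `p` of the list followed by an `r`-successor `q` with image segment
`[φ p, φ q]` meeting `B̄(x, ρ)` lies in the finite set `Q`, then the polyline through
`(a :: l).map φ` does not traverse `D(x; ρ, R)` (`ρ < R`) by `2 (#Q + 1) + 1` separate segments:
its times in `B̄(x, ρ)` are covered by `#Q + 1` order-connected pieces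
(`hasOrdConnectedCover_preimage_polylineFrom`, `segMeetCount_map_le_card_of_chain`) and
`le_of_hasTraversals_of_hasOrdConnectedCover` applies. (AB99 §1.a "short-distance cutoff",
quantitative lattice form; list version of `not_hasTraversals_toCurve_of_isPath` of the `δℍ`
template.) [cite: AizenmanBurchardDuke1999, §1.a] -/
theorem not_hasTraversals_polyline_map {α : Type*} [DecidableEq α] (φ : α → ℂ) (r : α → α → Prop)
    (a : α) (l : List α) (hchain : List.IsChain r (a :: l)) (hnd : (a :: l).Nodup)
    {x : ℂ} {ρ R : ℝ} (hρR : ρ < R) (Q : Finset α)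
    (hQ : ∀ p ∈ a :: l, ∀ q, r p q → (segment ℝ (φ p) (φ q) ∩ closedBall x ρ).Nonempty → p ∈ Q) :
    ¬ (⟨polyline ((a :: l).map φ)⟩ : Curve ℂ).HasTraversals (2 * (Q.card + 1) + 1) x ρ R := by
  -- adapted from `not_hasTraversals_toCurve_of_isPath`
  -- (Theorems/SAWDevelopingMapHexConjectureHexTightOfTraversalBound)
  classical
  intro htr
  have hcov := hasOrdConnectedCover_preimage_polylineFrom (convex_closedBall x ρ) (φ a) (l.map φ)
  have hpre : (⟨polyline ((a :: l).map φ)⟩ : Curve ℂ) ⁻¹' closedBall x ρ =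
      (polylineFrom (φ a) (l.map φ)).2 ⁻¹' closedBall x ρ := rfl
  rw [← hpre] at hcov
  have hcount : segMeetCount (closedBall x ρ) (φ a) (l.map φ) ≤ Q.card :=
    segMeetCount_map_le_card_of_chain (closedBall x ρ) φ r a l hchain hnd Q hQ
  have hle := le_of_hasTraversals_of_hasOrdConnectedCover hρR
    (hcov.mono (Nat.add_le_add_right hcount 1)) htr
  omega

/-- **(H0): the short-distance cutoff for Yang–Baxter polylines on the square tiling.** At mesh
`δ > 0`, the drawn walk `γ.path (π/2) δ` (the polyline through the rescaled midpoints of the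
pairwise distinct mid-edges crossed) traverses no shell `D(x; ρ, R)` with `ρ ≤ δ`, `ρ < R`, by
`147 = 2 · (72 + 1) + 1` separate segments: an arc whose rescaled segment meets `B̄(x, ρ)` starts
within `ρ + δ ≤ 2δ` of `x` (its two mid-edges are sides of a common unit square,
`norm_planeMidpoint_sub_le_of_commonFace`), all such start mid-edges lie in the box of `≤ 72`
mid-edges near `x` (`mem_midBox`), and the walk crosses each edge once
(`not_hasTraversals_polyline_map`). (AB99 §1.a: the lattice short-distance cutoff.)
[cite: AizenmanBurchardDuke1999, §1.a] -/
theorem not_hasTraversals_path {Ω : Set ℂ} {δ : ℝ} (hδ : 0 < δ) {a b : MidEdge}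
    (γ : YangBaxterSAW (fun (_ : ℤ) => Real.pi / 2) Ω δ a b) {x : ℂ} {ρ R : ℝ} (hρδ : ρ ≤ δ)
    (hρR : ρ < R) :
    ¬ (⟨γ.path (fun (_ : ℤ) => Real.pi / 2) δ⟩ : Curve ℂ).HasTraversals (2 * (72 + 1) + 1)
        x ρ R := by
  classical
  set φ : MidEdge → ℂ := fun e => (δ : ℂ) * planeMidpoint (fun (_ : ℤ) => Real.pi / 2) e with hφ
  -- the list of mid-edges is `a :: l`
  obtain ⟨l, hl⟩ : ∃ l, γ.mids = a :: l := by
    have h := γ.head_eq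
    rcases hm : γ.mids with _ | ⟨e, l⟩
    · simp [hm] at h
    · simp only [hm, List.head?_cons, Option.some.injEq] at h
      exact ⟨l, by rw [h]⟩
  have hpath : γ.path (fun (_ : ℤ) => Real.pi / 2) δ = polyline ((a :: l).map φ) := by
    unfold YBWalk.path YBWalk.points
    rw [hl]
  -- consecutive mid-edges are sides of a common face; no mid-edge is repeated
  have hchain : List.IsChain (fun e e' : MidEdge => ∃ f, MidEdge.commonFace e e' = some f)
      (a :: l) := by
    rw [← hl]
    exact isChain_of_forall_mem_zip γ.mids fun p hp => by
      obtain ⟨f, -, hf⟩ := γ.arc_mem p hp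
      exact ⟨f, hf⟩
  have hnd : (a :: l).Nodup := hl ▸ γ.nodup
  -- the start of an arc whose rescaled segment meets the small ball is within `2δ` of `x`
  have hnear : ∀ p q : MidEdge, (∃ f, MidEdge.commonFace p q = some f) →
      (segment ℝ (φ p) (φ q) ∩ closedBall x ρ).Nonempty → ‖φ p - x‖ ≤ 2 * δ := by
    rintro p q ⟨f, hf⟩ ⟨z, hzseg, hzball⟩
    have hd : dist (φ q) (φ p) ≤ δ := by
      rw [dist_comm, dist_eq_norm, hφ]
      simp only [← mul_sub, norm_mul, Complex.norm_real, Real.norm_of_nonneg hδ.le]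
      exact mul_le_of_le_one_right hδ.le (norm_planeMidpoint_sub_le_of_commonFace hf)
    have hz : z ∈ closedBall (φ p) δ :=
      (convex_closedBall _ _).segment_subset (mem_closedBall_self hδ.le) (mem_closedBall.2 hd) hzseg
    rw [mem_closedBall, dist_comm, dist_eq_norm] at hz
    rw [mem_closedBall, dist_eq_norm] at hzball
    have := norm_sub_le_norm_sub_add_norm_sub (φ p) z x
    linarith
  intro htr
  rw [hpath] at htr
  -- all relevant start mid-edges lie in the box of mid-edges near `x`
  set Q : Finset MidEdge :=
    ((Finset.Icc (⌊x.re / δ⌋ - 2) (⌊x.re / δ⌋ + 3) ×ˢ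
        Finset.Icc (⌊x.im / δ⌋ - 2) (⌊x.im / δ⌋ + 3)).image
      fun q : ℤ × ℤ => MidEdge.vert q.1 q.2) ∪
    ((Finset.Icc (⌊(x.re - δ / 2) / δ⌋ - 2) (⌊(x.re - δ / 2) / δ⌋ + 3) ×ˢ
        Finset.Icc (⌊(x.im + δ / 2) / δ⌋ - 2) (⌊(x.im + δ / 2) / δ⌋ + 3)).image
      fun q : ℤ × ℤ => MidEdge.slant q.1 q.2) with hQ
  have hk : 2 * (Q.card + 1) + 1 ≤ 2 * (72 + 1) + 1 := by
    have : Q.card ≤ 72 := card_union_image_window_le _ _ _ _ _ _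
    omega
  refine not_hasTraversals_polyline_map φ _ a l hchain hnd hρR Q
    (fun p _ q hpq hmeet => ?_) (htr.of_le hk)
  exact mem_midBox hδ (hnear p q hpq hmeet)

/-! ### The trivial walk -/

/-- **A walk without arcs is drawn as the constant curve at its starting midpoint**: its list of
mid-edges is `[a]`, so `γ.path Θ δ` is the constant polyline at `δ · planeMidpoint Θ a`.
[folklore] -/
theorem range_path_subset_of_arcs_eq_nil {Θ : ℤ → ℝ} {Δ : Set Face} {δ : ℝ} {a b : MidEdge}
    (γ : YBWalk Δ a b) (h : γ.arcs = []) :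
    Set.range (γ.path Θ δ) ⊆ {(δ : ℂ) * planeMidpoint Θ a} := by
  have hhead := γ.head_eq
  simp only [YBWalk.arcs, arcsOf] at h
  unfold YBWalk.path YBWalk.points
  generalize hm : γ.mids = m at hhead h
  rcases m with _ | ⟨e, _ | ⟨e', m⟩⟩
  · simp at hhead
  · simp only [List.head?_cons, Option.some.injEq] at hhead
    subst hhead
    rintro _ ⟨t, rfl⟩
    simp [polyline]
  · simp at h

end TightOfTraversalBound

open TightOfTraversalBound in
/-- **T2 of the crux `CompassSLE` (skeleton v2): traversal bound ⇒ tightness along the mesh** for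
Glazman–Manolescu's critical `π/2` Yang–Baxter walk. The Aizenman–Burchard multi-traversal bound for
the laws `ybLaw (π/2) D.carrier δ 1 (a δ) (b δ)` and the drawn walks `⟨γ.path (π/2) δ⟩` (a threshold
`k x ρ R`, constants `K ≥ 0`, `λ > 2`, `δ₀ > 0` with
`P_δ(⟨γ.path⟩ traverses D(x; ρ, R) k-fold) ≤ K (ρ/R)^λ` for `δ ∈ (0, δ₀]`, `δ ≤ ρ < R ≤ 1`) implies
`IsTightAlongMesh` of the curve classes `γ.curve (π/2) δ`, by the PROVED criterion
`isTightMeasureSet_of_traversalBounds` (AB99 Thms 1.1–1.2) with a closed disc containing `D` and the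
heads `δ · planeMidpoint (a δ)` as compact container (`d = 2`,
`exists_finset_card_le_cover_closedBall`), `X_δ γ = ⟨γ.path (π/2) δ⟩` (classes `γ.curve (π/2) δ`
definitionally), `T = (0, δ₁]`, threshold `max 147 k`, (H0) = `YBWalk.range_path_subset` /
`range_path_subset_of_arcs_eq_nil` + `not_hasTraversals_path`, (H1) = the hypothesis, and the bridge
`isTightAlongMesh_of_isTightMeasureSet_image` (`YBWalk.aemeasurable_curve`).
[cite: AizenmanBurchardDuke1999, Thms 1.1-1.2 and §1.a] -/
theorem stub_ybTightOfTraversalBound :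
    ∀ (D : DobrushinDomain) (a b : ℝ → MidEdge),
      IsYBEndpointApprox (fun (_ : ℤ) => Real.pi / 2) D a b →
      (∃ (k : ℂ → ℝ → ℝ → ℕ) (K lam δ₀ : ℝ), 0 ≤ K ∧ 2 < lam ∧ 0 < δ₀ ∧
        ∀ δ ∈ Set.Ioc (0 : ℝ) δ₀, ∀ (x : ℂ) (ρ R : ℝ), δ ≤ ρ → ρ < R → R ≤ 1 →
          ybLaw (fun (_ : ℤ) => Real.pi / 2) D.carrier δ 1 (a δ) (b δ)
              {γ | (⟨γ.path (fun (_ : ℤ) => Real.pi / 2) δ⟩ : Curve ℂ).HasTraversals (k x ρ R) x ρ R} ≤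
            ENNReal.ofReal (K * (ρ / R) ^ lam)) →
      IsTightAlongMesh
        (fun δ (γ : YangBaxterSAW (fun (_ : ℤ) => Real.pi / 2) D.carrier δ (a δ) (b δ)) =>
          γ.curve (fun (_ : ℤ) => Real.pi / 2) δ)
        (fun δ => ybLaw (fun (_ : ℤ) => Real.pi / 2) D.carrier δ 1 (a δ) (b δ)) := by
  intro D a b hab hTB
  -- the data of the traversal bound
  obtain ⟨k, K, lam, δ₀, hK, hlam, hδ₀, hbound⟩ := hTB
  -- the head `δ · planeMidpoint (a δ)` is within `1` of the marked point `a` for small `δ`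
  have hnear : ∀ᶠ δ : ℝ in 𝓝[>] (0 : ℝ),
      (δ : ℂ) * planeMidpoint (fun (_ : ℤ) => Real.pi / 2) (a δ) ∈ ball (D.pt 0) 1 :=
    hab.tendsto_fst.eventually_mem (ball_mem_nhds _ one_pos)
  obtain ⟨δ₂, hδ₂, hsub₂⟩ := mem_nhdsGT_iff_exists_Ioo_subset.1 hnear
  have hδ₂' : (0 : ℝ) < δ₂ := hδ₂
  -- a disc containing the domain and the unit disc about `a`
  obtain ⟨r, hr⟩ := D.isBounded.subset_closedBall (0 : ℂ)
  set rΛ : ℝ := max r 0 + ‖D.pt 0‖ + 1 with hrΛ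
  have hrΛ0 : 0 ≤ rΛ := by rw [hrΛ]; positivity
  have hΩ : D.carrier ⊆ closedBall (0 : ℂ) rΛ := hr.trans (closedBall_subset_closedBall (by
    rw [hrΛ]; linarith [le_max_left r 0, norm_nonneg (D.pt 0)]))
  have hball : ball (D.pt 0) 1 ⊆ closedBall (0 : ℂ) rΛ := by
    intro z hz
    rw [mem_ball] at hz
    rw [mem_closedBall, dist_zero_right]
    have := norm_le_norm_add_norm_sub' z (D.pt 0)
    rw [← dist_eq_norm] at this
    rw [hrΛ]
    linarith [le_max_right r 0]
  -- the mesh threshold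
  set δ₁ : ℝ := min (min δ₀ (δ₂ / 2)) 1 with hδ₁
  have hδ₁pos : 0 < δ₁ := lt_min (lt_min hδ₀ (half_pos hδ₂')) one_pos
  have hδ₁1 : δ₁ ≤ 1 := min_le_right _ _
  have hδ₁δ₀ : δ₁ ≤ δ₀ := (min_le_left _ _).trans (min_le_left _ _)
  have hδ₁δ₂ : δ₁ < δ₂ := ((min_le_left _ _).trans (min_le_right _ _)).trans_lt (half_lt_self hδ₂')
  -- the criterion
  have hmain := isTightMeasureSet_of_traversalBounds (E := ℂ) (isCompact_closedBall (0 : ℂ) rΛ)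
    (C := 9 * (rΛ + 2) ^ 2) (d := 2) (by norm_num)
    (fun ρ hρ hρ1 ↦ exists_finset_card_le_cover_closedBall hrΛ0 ρ hρ hρ1)
    (Ω := fun δ ↦ YangBaxterSAW (fun (_ : ℤ) => Real.pi / 2) D.carrier δ (a δ) (b δ))
    (fun δ ↦ ybLaw (fun (_ : ℤ) => Real.pi / 2) D.carrier δ 1 (a δ) (b δ))
    (fun δ γ ↦ (⟨γ.path (fun (_ : ℤ) => Real.pi / 2) δ⟩ : Curve ℂ))
    (fun x ρ R ↦ max (2 * (72 + 1) + 1) (k x ρ R)) (K := K) (lam := lam)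
    hK hlam (T := Set.Ioc 0 δ₁) (fun δ hδ ↦ ⟨hδ.1, hδ.2.trans hδ₁1⟩) ?_ ?_
  · exact isTightAlongMesh_of_isTightMeasureSet_image
      (Eventually.of_forall fun δ ↦ YBWalk.aemeasurable_curve _ _ _ _ _ _) hδ₁pos hmain
  · -- (H0): range in `Λ`, and the short-distance cutoff
    intro δ hδ
    have hδpos : 0 < δ := hδ.1
    refine Eventually.of_forall fun γ ↦ ⟨?_, fun x ρ R _ hρδ hρR htr ↦ ?_⟩
    · change Set.range (γ.path (fun (_ : ℤ) => Real.pi / 2) δ) ⊆ closedBall 0 rΛ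
      by_cases harcs : γ.arcs = []
      · refine (range_path_subset_of_arcs_eq_nil γ harcs).trans ?_
        rw [Set.singleton_subset_iff]
        exact hball (hsub₂ ⟨hδpos, hδ.2.trans_lt hδ₁δ₂⟩)
      · exact (YBWalk.range_path_subset γ harcs).trans hΩ
    · exact not_hasTraversals_path hδpos γ hρδ hρR (htr.of_le (le_max_left _ _))
  · -- (H1): the traversal bound, weakened in the threshold
    intro δ hδ x ρ R hδρ hρR hR1
    have hδ' : δ ∈ Set.Ioc 0 δ₀ := ⟨hδ.1, hδ.2.trans hδ₁δ₀⟩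
    exact le_trans (measure_mono fun γ hγ ↦ Curve.HasTraversals.of_le hγ (le_max_right _ _))
      (hbound δ hδ' x ρ R hδρ hρR hR1)

end Summit.CriticalPhenomena.SAWScalingLimit.Theorems.SAWCompassLatticeCompassSLE

end
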